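import Summits.BirchSwinnertonDyer.BirchSwinnertonDyer.Theorems.PrintCf2SplitBadTwoRestrictedSelmerCoinvariantsVanish
import Summits.BirchSwinnertonDyer.BirchSwinnertonDyer.Theorems.IwasawaTwistedCoinvariantsNoFiniteSubmodule
import Literature.NumberTheory.EllipticCurves.IwasawaTwistedCoinvariantsProofs
import HarnessLib

/-!
# Crux `PrintCf2.SplitBadTwoRankOneOfFacts` (stmt-BirchSwinnertonDyer-20368), road α v9.1 — brick B17, file 1:
# «`X_𝔮(K_∞, M)` has NO nonzero finite `Λ`-submodule» ⟺ «the TWISTED `Γ`-coinvariants of `𝔖_𝔮(K_∞, M)` vanish for one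
# twist `u ≡ 1 (mod p)`» — the displayed hypothesis `hY` of S3c₂'s collapsed four-index identity traded for a
# SURJECTIVITY on the restricted Selmer group itself (Greenberg's proof of LNM 1716 Prop. 4.14/4.15, last step)

Cell `bsd-print-cf2`, EXTRA WIDTH seat `bsd-line-cf2-p1-w4` g8 (prover-bsd-line-cf2-p1-w4-g8-0); `--supports
stmt-BirchSwinnertonDyer-20368` (helper, Theses-free). HONEST FRAMING: nothing here closes the crux or a registered stub; BSD is
not proved by any of this; no summit statement is proved by this seat. No definition, no named fact, no `sorry`.

WHAT. LEAD g11's `control_identity_of_frame_of_noFiniteSubmodule` (p657357) carries the structural hypothesis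
`hY : ∀ N : Submodule (IwasawaAlgebra 2) D.X, Finite N → N = ⊥` («Agboola's `X_{v̄}(K*_∞, W*)` has no nonzero finite
`Λ`-submodule», Agboola 2007 Prop. 5.1 = Greenberg 1978 + control; brick B17 of the planner's menu). Greenberg's own proof of
this kind of statement (LNM 1716, Props. 4.14–4.15, pp. 123–125) ends: "Hence `S_M(F_∞)_Γ = 0`. This implies that
`S_M(F_∞)` has no proper `Λ`-submodules of finite index" — with `M = A_s` a TWIST, i.e. the `Γ`-coinvariants of the Selmer
group for the twisted action `c ↦ u·conj_γ c`, `u = κ(γ)^s ≡ 1 (mod p)`. The `Λ`-algebra of that last step is in the tree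
(`IwasawaDual.forall_finite_eq_bot_of_forall_exists`, `IwasawaDual.finite_setOf_not_forall_exists`,
`TwistedCoinvariants.forall_finite_eq_bot_of_sub_nsmul_surjective`), stated on abstract dual data. This file instantiates
it on Agboola's restricted Selmer group `𝔖_𝔮(K_∞, M) = Agboola2007.restrictedSelmerZp κ M 𝔮` and its dual data
`Agboola2007.RestrictedDualData κ M 𝔮 γ` (whose axioms `toDual_T_smul` / `toDual_C_smul` are exactly the abstract ones):

* §1 (GENERIC: any number field `K`, prime `p`, `ℤ_p`-line `κ`, `γ ∈ Γ_K`, `p`-primary discrete `M`, place `𝔮`, dual datum `D`)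
  - `forall_finite_eq_bot_of_twistedCoinvariants`: **if `ψ_u := u·conj_γ − 1` maps `𝔖_𝔮(K_∞, M)` ONTO itself for ONE integer
    `u ≡ 1 (mod p)`, then `D.X` has no nonzero finite `Λ`-submodule** (only `p`-primarity of `M` is used);
  - `forall_finite_eq_bot_of_conj_sub_nsmul_surjective`: the same with the twist written `conj_γ − (1 + c)`, `p ∣ c`
    (through LEAD g10's `RestrictedDualData.isDualPair`);
  - `finite_setOf_not_twistedCoinvariants`: CONVERSELY, if `D.X` is finitely generated without nonzero finite
    `Λ`-submodules then `ψ_u` is onto for all but finitely many `u ≡ 1 (mod p)`;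
  - `forall_finite_eq_bot_iff_exists_twistedCoinvariants`: for `D.X` finitely generated, **B17 ⟺ ∃ `u ≡ 1 (mod p)` with
    `ψ_u(𝔖) = 𝔖`** (`{u ≡ 1 (mod p)}` is infinite);
  - `natCard_endCoinvariants_eq_one_of_twistedCoinvariants`: `#𝔖_Γ = 1` from the twisted surjectivity (+ `𝔖_Γ` finite).
* §2 (ROAD α, every S3c₂ frame over `K ∋ √−7`): `control_identity_of_frame_of_twistedCoinvariants` — LEAD's collapsed identity
  `#𝔖_Γ = 1 ∧ v₂ #ker ≤ 1 ∧ n + v₂ #ker = v₂ #𝔖_{v̄}(K, W*) + v₂ [𝔖^Γ : res]` with `hY` REPLACED by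
  «`∃ u ≡ 1 (mod 2)`, `u·conj_{γ'} − 1` onto `𝔖_{v̄}(K*_∞, W*)`».
So what B17 asks of the line is now a statement about `𝔖_{v̄}(K*_∞, W*)` alone: the vanishing of ONE twisted coinvariant
group — the target of Greenberg's diagram chase (file 2 of this brick: the chase with its two `Γ`-cohomological inputs).
presearch: Greenberg LNM 1716 pp. 123–125 (held, book:coates1999 p0124–p0126); Agboola 2007 Prop. 5.1 (held, p0012: "a slight
modification of the arguments given in [Gr78] … we omit the details"); Greenberg 2016 Prop. 4.1.1 (tree fact
`Greenberg2016.prop411_selmer_isAlmostDivisible`, other cohomology model) — no new fact filed.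

References: [GreenbergLNM1716] §4 Props. 4.14–4.15 (pp. 123–125), §1 p. 60; [Agboola2007] §5 Prop. 5.1 (arXiv p0012 L13–24);
[Washington1997] §13.2.
-/

noncomputable section

open scoped Classical

set_option linter.dupNamespace false
set_option autoImplicit false

open NumberField IsDedekindDomain Field WeierstrassCurve
open Literature.NumberTheory.EllipticCurves Literature.NumberTheory.EllipticCurves.GreenbergSelmer
open Literature.NumberTheory.EllipticCurves.Agboola2007
open Literature.NumberTheory.EllipticCurves.IwasawaAlgebra
open Literature.NumberTheory.EllipticCurves.IwasawaDual
open Literature.NumberTheory.EllipticCurves.ResKernel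
open Literature.NumberTheory.EllipticCurves.PontryaginCard
open Literature.NumberTheory.GaloisRepresentations

universe u

namespace Summit.BirchSwinnertonDyer.BirchSwinnertonDyer.Theorems.PrintCf2.RestrictedSelmerPair

/-! ## §1. Generic: no finite `Λ`-submodule ⟺ twisted coinvariants of `𝔖_𝔮(K_∞, M)` vanish for one twist -/

section Generic

variable {K : Type u} [Field K] [NumberField K] {p : ℕ} [Fact p.Prime] {κ : ZpExtension K p}
  {M : Type u} [AddCommGroup M] [DistribMulAction (absoluteGaloisGroup K) M] [TopologicalSpace M]
  [DiscreteTopology M] {𝔮 : HeightOneSpectrum (𝓞 K)} {γ : absoluteGaloisGroup K}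

/-- `𝔖_𝔮(K_∞, M)` is `p`-primary when `M` is: every class is killed by a power of `p` (the tree's
`GreenbergSelmer.exists_pow_smul_subgroupH1_eq_zero` on `H¹(K_∞, M)`). [cite: GreenbergLNM1716, §1 p. 60] -/
theorem exists_pow_smul_restrictedSelmerZp_eq_zero (htor : ∀ m : M, ∃ k : ℕ, p ^ k • m = 0)
    (s : restrictedSelmerZp κ M 𝔮) : ∃ k : ℕ, p ^ k • s = 0 := by
  obtain ⟨k, hk⟩ := GreenbergSelmer.exists_pow_smul_subgroupH1_eq_zero κ M htor (s : subgroupH1 κ.kerSubgroup M)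
  exact ⟨k, Subtype.ext (by rw [AddSubgroupClass.coe_nsmul]; exact hk)⟩

/-- **Twisted coinvariants zero ⟹ `X_𝔮(K_∞, M)` has no nonzero finite `Λ`-submodule.** For any dual datum `D` of the
restricted Selmer group of a `p`-primary `M`: if for ONE integer `u ≡ 1 (mod p)` the twisted coboundary
`ψ_u = u·conj_γ − 1` maps `𝔖_𝔮(K_∞, M)` onto itself ("`S_M(F_∞)_Γ = 0`" for the twist `M = A_s`, `κ(γ)^s = u`), then every
finite `Λ`-submodule of `D.X` is `⊥` (`θ_u = u(1+T) − 1 ∈ 𝔪_Λ` acts injectively on `X`; Nakayama).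
[cite: GreenbergLNM1716, §4 p. 124 (proof of Prop. 4.14): "Hence S_M(F_∞)_Γ = 0. This implies that S_M(F_∞) has no proper Λ-submodules of finite index"]
[cite: Washington1997, §13.2] -/
theorem forall_finite_eq_bot_of_twistedCoinvariants (D : RestrictedDualData κ M 𝔮 γ)
    (htor : ∀ m : M, ∃ k : ℕ, p ^ k • m = 0) {u : ℤ} (hu : (p : ℤ) ∣ u - 1)
    (hsurj : ∀ s : restrictedSelmerZp κ M 𝔮, ∃ t : restrictedSelmerZp κ M 𝔮,
      u • conjRestricted κ M 𝔮 γ t - t = s) :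
    ∀ N : Submodule (IwasawaAlgebra p) D.X, Finite N → N = ⊥ :=
  IwasawaDual.forall_finite_eq_bot_of_forall_exists (conjRestricted κ M 𝔮 γ) D.toDual
    (exists_pow_smul_restrictedSelmerZp_eq_zero htor) D.toDual_T_smul D.toDual_C_smul D.bijective.1 hu hsurj

/-- The same with Greenberg's twist written `conj_γ − (1 + c)`, `p ∣ c` (`1 + c = κ(γ)^{-s}`): if `conj_γ − (1+c)` is onto
`𝔖_𝔮(K_∞, M)` then `D.X` has no nonzero finite `Λ`-submodule — through the dual pair
(`RestrictedDualData.isDualPair`, LEAD g10) and the tree's `TwistedCoinvariants.forall_finite_eq_bot_of_sub_nsmul_surjective`.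
[cite: GreenbergLNM1716, §4 pp. 105, 124] -/
theorem forall_finite_eq_bot_of_conj_sub_nsmul_surjective (D : RestrictedDualData κ M 𝔮 γ)
    (htor : ∀ m : M, ∃ k : ℕ, p ^ k • m = 0)
    (hstab : ∀ m : M, IsOpen (MulAction.stabilizer (absoluteGaloisGroup K) m : Set (absoluteGaloisGroup K)))
    (hγ : κ.IsTopGenerator γ) {c : ℕ} (hc : p ∣ c)
    (hsurj : ∀ s : restrictedSelmerZp κ M 𝔮, ∃ t : restrictedSelmerZp κ M 𝔮,
      conjRestricted κ M 𝔮 γ t - (1 + c) • t = s) :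
    ∀ N : Submodule (IwasawaAlgebra p) D.X, Finite N → N = ⊥ := by
  refine TwistedCoinvariants.forall_finite_eq_bot_of_sub_nsmul_surjective p (D.isDualPair htor hstab hγ) hc fun s ↦ ?_
  obtain ⟨t, ht⟩ := hsurj s
  refine ⟨t, ?_⟩
  rw [← ht, IwasawaDual.End_sub_apply, AddMonoid.End.one_apply, add_nsmul, one_nsmul]
  abel

/-- **Conversely: no finite submodule ⟹ the twisted coinvariants vanish GENERICALLY.** If `D.X` is finitely generated over
`Λ` and has no nonzero finite `Λ`-submodule, then `ψ_u = u·conj_γ − 1` maps `𝔖_𝔮(K_∞, M)` onto itself for all but finitely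
many integers `u ≡ 1 (mod p)` (`X[θ_u] ≠ 0` for finitely many twists only; `toDual` is onto `Hom(𝔖, ℚ/ℤ)`).
[cite: GreenbergLNM1716, §4 pp. 117, 124] -/
theorem finite_setOf_not_twistedCoinvariants (D : RestrictedDualData κ M 𝔮 γ) [Module.Finite (IwasawaAlgebra p) D.X]
    (htor : ∀ m : M, ∃ k : ℕ, p ^ k • m = 0) (hX : ∀ N : Submodule (IwasawaAlgebra p) D.X, Finite N → N = ⊥) :
    {u : ℤ | (p : ℤ) ∣ u - 1 ∧ ¬ ∀ s : restrictedSelmerZp κ M 𝔮, ∃ t : restrictedSelmerZp κ M 𝔮,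
      u • conjRestricted κ M 𝔮 γ t - t = s}.Finite :=
  IwasawaDual.finite_setOf_not_forall_exists (conjRestricted κ M 𝔮 γ) D.toDual
    (exists_pow_smul_restrictedSelmerZp_eq_zero htor) D.toDual_T_smul D.toDual_C_smul D.bijective hX

/-- The integers `u ≡ 1 (mod p)` form an infinite set (`u = 1 + p k`). [folklore] -/
theorem infinite_setOf_dvd_sub_one : {u : ℤ | (p : ℤ) ∣ u - 1}.Infinite := by
  refine Set.infinite_of_injective_forall_mem (f := fun k : ℕ ↦ (1 + p * k : ℤ)) (fun a b hab ↦ ?_) fun k ↦ ?_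
  · have hp0 : (p : ℤ) ≠ 0 := by exact_mod_cast (Fact.out : p.Prime).ne_zero
    have h : (p : ℤ) * a = (p : ℤ) * b := by simpa using hab
    exact_mod_cast mul_left_cancel₀ hp0 h
  · show (p : ℤ) ∣ (1 + p * k : ℤ) - 1
    exact ⟨k, by ring⟩

/-- **B17 as an equivalence.** For a finitely generated dual datum `D` of `𝔖_𝔮(K_∞, M)` (`M` `p`-primary):
`D.X` has no nonzero finite `Λ`-submodule **iff** for SOME integer `u ≡ 1 (mod p)` the twisted coboundary `u·conj_γ − 1`
maps `𝔖_𝔮(K_∞, M)` onto itself (and then for all but finitely many such `u`).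
[cite: GreenbergLNM1716, §4 pp. 117, 123–125] -/
theorem forall_finite_eq_bot_iff_exists_twistedCoinvariants (D : RestrictedDualData κ M 𝔮 γ)
    [Module.Finite (IwasawaAlgebra p) D.X] (htor : ∀ m : M, ∃ k : ℕ, p ^ k • m = 0) :
    (∀ N : Submodule (IwasawaAlgebra p) D.X, Finite N → N = ⊥) ↔
      ∃ u : ℤ, (p : ℤ) ∣ u - 1 ∧ ∀ s : restrictedSelmerZp κ M 𝔮, ∃ t : restrictedSelmerZp κ M 𝔮,
        u • conjRestricted κ M 𝔮 γ t - t = s := by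
  constructor
  · intro hX
    have hfin := finite_setOf_not_twistedCoinvariants D htor hX
    have hinf : ({u : ℤ | (p : ℤ) ∣ u - 1} \ {u : ℤ | (p : ℤ) ∣ u - 1 ∧
        ¬ ∀ s : restrictedSelmerZp κ M 𝔮, ∃ t : restrictedSelmerZp κ M 𝔮,
          u • conjRestricted κ M 𝔮 γ t - t = s}).Infinite :=
      infinite_setOf_dvd_sub_one.sdiff hfin
    obtain ⟨u, hu, hnot⟩ := hinf.nonempty
    refine ⟨u, hu, ?_⟩
    by_contra h
    exact hnot ⟨hu, h⟩
  · rintro ⟨u, hu, hsurj⟩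
    exact forall_finite_eq_bot_of_twistedCoinvariants D htor hu hsurj

/-- **`#𝔖_Γ = 1` from the twisted surjectivity** (and `𝔖_Γ` finite): LEAD's
`natCard_endCoinvariants_eq_one_of_noFiniteSubmodule` with its hypothesis `hY` supplied by
`forall_finite_eq_bot_of_twistedCoinvariants`. [cite: GreenbergLNM1716, §1 p. 60 and §4 pp. 123–125] [cite: Agboola2007, §5] -/
theorem natCard_endCoinvariants_eq_one_of_twistedCoinvariants (D : RestrictedDualData κ M 𝔮 γ)
    (htor : ∀ m : M, ∃ k : ℕ, p ^ k • m = 0)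
    (hstab : ∀ m : M, IsOpen (MulAction.stabilizer (absoluteGaloisGroup K) m : Set (absoluteGaloisGroup K)))
    (hγ : κ.IsTopGenerator γ) {u : ℤ} (hu : (p : ℤ) ∣ u - 1)
    (hsurj : ∀ s : restrictedSelmerZp κ M 𝔮, ∃ t : restrictedSelmerZp κ M 𝔮,
      u • conjRestricted κ M 𝔮 γ t - t = s)
    (hfin : Finite (EndCoinvariants (conjRestricted κ M 𝔮 γ - 1))) :
    Nat.card (EndCoinvariants (conjRestricted κ M 𝔮 γ - 1)) = 1 :=
  natCard_endCoinvariants_eq_one_of_noFiniteSubmodule D htor hstab hγ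
    (forall_finite_eq_bot_of_twistedCoinvariants D htor hu hsurj) hfin

/-- With the twisted surjectivity, `HasCharValuationAt n` reads `n = v_p #𝔖^Γ` exactly and `#𝔖_Γ = 1` (LEAD's
`eq_padicValNat_card_endInvariants_of_noFiniteSubmodule`, `hY` supplied). [cite: GreenbergLNM1716, §4 Lemma 4.2 and pp. 123–125] -/
theorem eq_padicValNat_card_endInvariants_of_twistedCoinvariants (D : RestrictedDualData κ M 𝔮 γ)
    (htor : ∀ m : M, ∃ k : ℕ, p ^ k • m = 0)
    (hstab : ∀ m : M, IsOpen (MulAction.stabilizer (absoluteGaloisGroup K) m : Set (absoluteGaloisGroup K)))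
    (hγ : κ.IsTopGenerator γ) [Module.Finite (IwasawaAlgebra p) D.X] {n : ℕ} (hD : D.HasCharValuationAt n)
    {u : ℤ} (hu : (p : ℤ) ∣ u - 1)
    (hsurj : ∀ s : restrictedSelmerZp κ M 𝔮, ∃ t : restrictedSelmerZp κ M 𝔮,
      u • conjRestricted κ M 𝔮 γ t - t = s) :
    Nat.card (EndCoinvariants (conjRestricted κ M 𝔮 γ - 1)) = 1 ∧
      n = padicValNat p (Nat.card (endInvariants (conjRestricted κ M 𝔮 γ - 1))) :=
  eq_padicValNat_card_endInvariants_of_noFiniteSubmodule D htor hstab hγ hD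
    (forall_finite_eq_bot_of_twistedCoinvariants D htor hu hsurj)

end Generic

/-! ## §2. Road α: the collapsed four-index identity with `hY` replaced by the twisted surjectivity -/

section Frame

variable {K : Type} [Field K] [NumberField K]

/-- **S3c₂'s four-index identity COLLAPSED on every frame over `K ∋ √−7`, from ONE twisted surjectivity.** For a member
`C • W = cm7^{(d)}`, `K` imaginary quadratic with `θ² = −7`, `v̄ ∣ 2`, `π² = π − 2`, `r² = r − 2`, a line `κ'` unramified outside
`v̄` with generator `γ'`, and a dual datum `D` (finitely generated, `HasCharValuationAt n`) such that for SOME integer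
`u ≡ 1 (mod 2)` the twisted coboundary `u·conj_{γ'} − 1` maps `𝔖_{v̄}(K*_∞, W*)` onto itself: `#𝔖_Γ = 1`, `v₂ #ker ≤ 1`, and
**`n + v₂ #ker = v₂ #𝔖_{v̄}(K, W*) + v₂ [𝔖^Γ : res 𝔖_{v̄}(K, W*)]`** — LEAD g11's `control_identity_of_frame_of_noFiniteSubmodule`
(p657357) with its structural hypothesis `hY` DISCHARGED from the surjectivity (§1).
[cite: Agboola2007, §5 Prop. 5.1, §6, Prop. 8.1] [cite: GreenbergLNM1716, §4 Lemma 4.2, Props. 4.14–4.15] -/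
theorem control_identity_of_frame_of_twistedCoinvariants {d : ℤ} (hd0 : d ≠ 0) (W : WeierstrassCurve ℚ) [W.IsElliptic]
    (C : VariableChange ℚ) (hC : C • W = cm7.quadraticTwist (d : ℚ)) (hK : IsImaginaryQuadratic K) {θ : K} (hθ : θ ^ 2 = -7)
    (vbar : HeightOneSpectrum (𝓞 K)) (hvbar : ((2 : ℕ) : 𝓞 K) ∈ vbar.asIdeal)
    (π : (W.baseChange K).endRing) (hrel : (π : AddMonoid.End (W.baseChange K).geomPoints) * π = π - 2)
    {r : ℤ_[2]} (hr : r * r = r - 2) (κ' : ZpExtension K 2) (hκ' : κ'.IsUnramifiedOutside vbar)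
    {γ' : absoluteGaloisGroup K} (hγ' : κ'.IsTopGenerator γ')
    (D : RestrictedDualData κ' ↥((W.baseChange K).endEigenPrimaryTorsion 2 π r) vbar γ')
    [Module.Finite (IwasawaAlgebra 2) D.X] {n : ℕ} (hD : D.HasCharValuationAt n)
    {u : ℤ} (hu : (2 : ℤ) ∣ u - 1)
    (hsurj : ∀ s : restrictedSelmerZp κ' ↥((W.baseChange K).endEigenPrimaryTorsion 2 π r) vbar,
      ∃ t : restrictedSelmerZp κ' ↥((W.baseChange K).endEigenPrimaryTorsion 2 π r) vbar,
        u • conjRestricted κ' ↥((W.baseChange K).endEigenPrimaryTorsion 2 π r) vbar γ' t - t = s) :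
    Nat.card (EndCoinvariants (conjRestricted κ' ↥((W.baseChange K).endEigenPrimaryTorsion 2 π r) vbar γ' - 1)) = 1 ∧
    padicValNat 2 (Nat.card ↥(restrictedSelmerBase ↥((W.baseChange K).endEigenPrimaryTorsion 2 π r) 2 vbar ⊓
        (resOfLe ↥((W.baseChange K).endEigenPrimaryTorsion 2 π r) (le_top : κ'.kerSubgroup ≤ ⊤)).ker)) ≤ 1 ∧
      n + padicValNat 2 (Nat.card ↥(restrictedSelmerBase ↥((W.baseChange K).endEigenPrimaryTorsion 2 π r) 2 vbar ⊓
            (resOfLe ↥((W.baseChange K).endEigenPrimaryTorsion 2 π r) (le_top : κ'.kerSubgroup ≤ ⊤)).ker)) =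
        padicValNat 2 (Nat.card (restrictedSelmerBase ↥((W.baseChange K).endEigenPrimaryTorsion 2 π r) 2 vbar)) +
          padicValNat 2 ((((restrictedSelmerBase ↥((W.baseChange K).endEigenPrimaryTorsion 2 π r) 2 vbar).map
              (resOfLe ↥((W.baseChange K).endEigenPrimaryTorsion 2 π r) (le_top : κ'.kerSubgroup ≤ ⊤))).addSubgroupOf
              (restrictedSelmerZp κ' ↥((W.baseChange K).endEigenPrimaryTorsion 2 π r) vbar)).relIndex
            (endInvariants (conjRestricted κ' ↥((W.baseChange K).endEigenPrimaryTorsion 2 π r) vbar γ' - 1))) := by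
  haveI : (W.baseChange K).IsElliptic := by rw [baseChange]; infer_instance
  have htor := exists_pow_smul_endEigenPrimaryTorsion_eq_zero (W.baseChange K) 2 π r
  have hY : ∀ N : Submodule (IwasawaAlgebra 2) D.X, Finite N → N = ⊥ :=
    forall_finite_eq_bot_of_twistedCoinvariants D htor (by exact_mod_cast hu) hsurj
  exact control_identity_of_frame_of_noFiniteSubmodule hd0 W C hC hK hθ vbar hvbar π hrel hr κ' hκ' hγ' D hD hY

end Frame

end Summit.BirchSwinnertonDyer.BirchSwinnertonDyer.Theorems.PrintCf2.RestrictedSelmerPair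

end
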